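import Summits.BirchSwinnertonDyer.BirchSwinnertonDyer.Theorems.AdditiveKolyvaginRoadAdmissibleJump
import Summits.BirchSwinnertonDyer.BirchSwinnertonDyer.Theorems.AdditiveKolyvaginRoadAdmissibleHyperbolic
import Summits.BirchSwinnertonDyer.BirchSwinnertonDyer.Theorems.AdditiveKolyvaginRoadRankLoweringReduction
import Summits.BirchSwinnertonDyer.BirchSwinnertonDyer.Theorems.AdditiveKolyvaginRoadAdmissibleStab
import Summits.BirchSwinnertonDyer.BirchSwinnertonDyer.Theorems.AdditiveKolyvaginRoadEigen
import Summits.BirchSwinnertonDyer.BirchSwinnertonDyer.Theorems.AdditiveKolyvaginRoadLocalEquiv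
import HarnessLib

/-!
# Route `AdditiveKolyvaginRoad`, crux `LevelKolyvaginSystemsAdditive` (item stmt-BirchSwinnertonDyer-21396, KS′):
# (R) ONE-PRIME RAISING for the canonical spaces — W. Zhang 2014 Lemma 5.3 ∕ Prop. 5.4, RAISING half, PROVED
# (modulo the named Poitou–Tate fact; step 3 = assembly of R-ROADMAP on 21396)
# (cell `pub/bsd-wall`, lead prover `bsd-wall-akr-p2x` g0, line `birth`; `--supports stmt-BirchSwinnertonDyer-21396`, helper)

WHAT. `selQP_raise_of_admQ`: at a frame with `K` imaginary quadratic, `p` odd, complex conjugation `c ≠ 1` and the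
named PT fact: for a finite set `n` of Bertolini–Darmon admissible primes, an admissible `q ∉ n` with place `v`, a sign
`s` and an `s`-eigenclass `z ∈ H¹(K, E[p])` which is KUMMER at `v` but NOT locally trivial at `v` (so `ε_q = s`): if
every class of `Sel_n^s` is locally trivial at `v`, then `dim Sel_{n∪{q}}^s = dim Sel_n^s + 1`. This is the binder
`hraise` of `kolyvaginPrimitive_of_levelSystem_of_rankOne_of_raise` (`…LevelSystemsBottomOfRaise`), whence — with
the LANDED (A1), Čebotarev, (Equiv) — THE BOTTOM CRUX BOT′ IS A COROLLARY OF KS′ modulo PUB-type named facts only.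

PROOF. (1) JUMP (`exists_relaxed_notMem_torsionLocalKer_of_admQ`): a class `g` Kummer at `∞` and off `n ∪ v`, toric
above `n`, free at `v`, `loc_v g ≠ 0`. (2) SIGN: the relaxed conditions are `c`-stable (`conjAct_mem_relaxedAt`), `p` odd
(`2u ≡ 1`), so `g = g_s + g_{¬s}` in the relaxed group; `ε_v = s` (`localEquiv_of_admQ` + (9.2) at `z`), so `loc_v g_s ≠ 0`.
(3) ISOTROPY: `g_s` is Kummer outside `S' = {v} ∪ {places above n}`; Poitou–Tate reciprocity
(`sum_invWeilPairing_localization_eq_zero_of_mem_kummerOutside`) and toric isotropy above `n` give `inv_v(loc g_s ∪ loc g_s)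
= 0`. (4) HYPERBOLIC PLANE (`mem_selmerLocalKer_or_mem_toricLocalKer_of_isotropic` with the witness `z`): `g_s` is toric at
`v` (Kummer would put it in `Sel_n^s`, locally trivial at `v`), so `g_s ∈ Sel_{n∪q}^s ∖ Sel_n^s`. (5) COUNT:
`Sel_n^s = Sel_{n∪q}^s ∩ ker loc_v` (`selQP_insert_inf_kummer_eq`), localisations of `Sel_{n∪q}^s` in the toric line
(dimension ≤ 1), rank–nullity (`ZhangInduction.finrank_inf_ker_add_one_of_line`).
HONEST FRAMING: theorems only; 0 definitions, 0 named facts, 0 `sorry`; CONDITIONAL on `poitouTate_selmerStructure_duality K`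
(the route's DUAL input, as for (Supply)); closes nothing. BSD is not proved by any of this.
References: [cite: WZhang2014, Lemma 5.3, Prop. 5.4, §9 (9.2)–(9.3)] [cite: BertoliniDarmon2005, §2.2–§2.3, Lemma 2.6]
[cite: GrossLMS1991, §5 (5.1)] [cite: MilneADT2006, Ch. I, Thm. 4.10] [cite: McCallumLMS1991, Prop. 2.1].
-/

-- single-conjunct summit: `Summit.BirchSwinnertonDyer.BirchSwinnertonDyer.…` repeats the name by design
set_option linter.dupNamespace false

noncomputable section

open scoped Classical NumberField Pointwise
open Function NumberField IsDedekindDomain Field WeierstrassCurve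
open Literature.NumberTheory.EllipticCurves Literature.NumberTheory.EllipticCurves.ModularForms
open Literature.NumberTheory.GaloisRepresentations Literature.NumberTheory.GaloisRepresentations.DiscreteGaloisModule
  Literature.NumberTheory.GaloisCohomology Module
open Summit.BirchSwinnertonDyer.Rank1Residual.X11b.FiniteDuality
open Summit.BirchSwinnertonDyer.Rank1Residual.X11b.Relaxation
open Summit.BirchSwinnertonDyer.Rank1Residual.X11b
open Summit.BirchSwinnertonDyer.Rank1Residual.GaloisImage
open Summit.BirchSwinnertonDyer.Rank1Residual.X11b.Three.Koly.Method2
open Summit.BirchSwinnertonDyer.Rank1Residual.X11b.Three.Koly.ZhangSupply.LocalConj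
open Literature.NumberTheory.Automorphic

namespace Summit.BirchSwinnertonDyer.BirchSwinnertonDyer.Theorems.AdditiveKoly

variable (W : WeierstrassCurve ℚ) (K : Type) [Field K] [NumberField K] (p : ℕ) [W.IsElliptic] [W.IsGloballyMinimal]
  [Fact p.Prime] [Module (ZMod p) (Vp W K p)]
  [∀ v : Place K, CompactSpace (absoluteGaloisGroup (Place.Completion v))]

/-! ## (R) ONE-PRIME RAISING -/

-- the five-step assembly elaborates in ≈ 2.5·10⁵ heartbeats (one `cases` on the sign over a large context);
-- same budget as `localEquiv_of_admQ`
set_option maxHeartbeats 400000 in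
/-- **(R) ONE-PRIME RAISING for the canonical spaces `SelQP`, PROVED modulo the Poitou–Tate fact** (W. Zhang 2014
Lemma 5.3 ∕ Prop. 5.4, raising half; Gross–Parson): `K` imaginary quadratic, `p` odd, `c ≠ 1`,
`poitouTate_selmerStructure_duality K`; `n` a finite set of BD-admissible primes, `q ∉ n` admissible with place `v`, `z` an
`s`-eigenclass Kummer at `v` and not locally trivial at `v`; if `Sel_n^s` is locally trivial at `v` then
`dim Sel_{n∪{q}}^s = dim Sel_n^s + 1`. See the module docstring for the five steps. [cite: WZhang2014, Lemma 5.3, Prop. 5.4]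
[cite: BertoliniDarmon2005, Lemma 2.6] [cite: MilneADT2006, Ch. I, Thm. 4.10] -/
theorem selQP_raise_of_admQ (hK : IsImaginaryQuadratic K) (hp2 : p ≠ 2) {c : K ≃ₐ[ℚ] K} (hc1 : c ≠ 1) (hPT : poitouTate_selmerStructure_duality K) :
    ∀ (n : Finset (AdmQ W K p)) (q : AdmQ W K p) (s : Bool) (z : Vp W K p) (v : HeightOneSpectrum (𝓞 K)),
      q ∉ n → ((q : ℕ) : 𝓞 K) ∈ v.asIdeal →
      conjAct W c ((p ^ 1 : ℕ) : ℤ) z = sgnP s • z →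
      z ∈ selmerLocalKer (W.baseChange K) (v.adicCompletion K) ((p ^ 1 : ℕ) : ℤ) →
      z ∉ (W.baseChange K).torsionLocalKer (v.adicCompletion K) ((p ^ 1 : ℕ) : ℤ) →
      (∀ y ∈ SelQP W K p c n s, y ∈ (W.baseChange K).torsionLocalKer (v.adicCompletion K) ((p ^ 1 : ℕ) : ℤ)) →
      finrank (ZMod p) (SelQP W K p c (insert q n) s) = finrank (ZMod p) (SelQP W K p c n s) + 1 := by
  intro n q s z v hqn hv hzs hzK hzv hSel
  have hp : p.Prime := Fact.out
  haveI : NeZero (p ^ 1 : ℕ) := ⟨pow_ne_zero 1 hp.ne_zero⟩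
  haveI : IsTotallyComplex K := hK.2
  have hK2 : Module.finrank ℚ K = 2 := hK.1; have hcc : c * c = 1 := algEquiv_mul_self_eq_one K hK c
  set τ := conjAct W c ((p ^ 1 : ℕ) : ℤ) with hτ
  have hττ : ∀ y : Vp W K p, τ (τ y) = y := fun y ↦ conjAct_conjAct_of_mul_self W hcc ((p ^ 1 : ℕ) : ℤ) y
  -- the unique place above the inert `q`
  have hq0 : (q : ℕ) ≠ 0 := q.2.1.ne_zero
  have hqP : (Ideal.span {((q : ℕ) : 𝓞 K)}).IsPrime := q.2.2.2.1
  have huniq : ∀ v' : HeightOneSpectrum (𝓞 K), ((q : ℕ) : 𝓞 K) ∈ v'.asIdeal → v' = v := by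
    have hspan : ∀ w : HeightOneSpectrum (𝓞 K), ((q : ℕ) : 𝓞 K) ∈ w.asIdeal →
        w.asIdeal = Ideal.span {((q : ℕ) : 𝓞 K)} := fun w hw ↦ by
      have hle : Ideal.span {((q : ℕ) : 𝓞 K)} ≤ w.asIdeal := by
        rw [Ideal.span_le, Set.singleton_subset_iff]; exact hw
      have hne : Ideal.span {((q : ℕ) : 𝓞 K)} ≠ ⊥ := by
        rw [Ne, Ideal.span_singleton_eq_bot]; exact_mod_cast hq0
      exact ((hqP.isMaximal hne).eq_of_le w.isPrime.ne_top hle).symm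
    intro v' hv'
    exact HeightOneSpectrum.ext (by rw [hspan v hv, hspan v' hv'])
  have hqn' : ∀ q' ∈ n, ∀ v' : HeightOneSpectrum (𝓞 K), ((q' : ℕ) : 𝓞 K) ∈ v'.asIdeal →
      ((q : ℕ) : 𝓞 K) ∉ v'.asIdeal := by
    intro q' hq' v' hq'v' hqv'
    have h := disjoint_places_of_admQ W K p n ∅ q hqn (Set.notMem_empty _) v' hqv' (q' : ℕ)
      (Or.inl (Finset.mem_coe.mpr (Finset.mem_image_of_mem _ hq')))
    exact h hq'v'
  -- the relaxed conditions (Kummer at `∞`, Kummer off `n ∪ q`, toric above `n`) as a predicate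
  set REL : Vp W K p → Prop := fun x ↦
    (∀ u : InfinitePlace K, x ∈ selmerLocalKer (W.baseChange K) u.Completion ((p ^ 1 : ℕ) : ℤ)) ∧
      (∀ v' : HeightOneSpectrum (𝓞 K), ((q : ℕ) : 𝓞 K) ∉ v'.asIdeal →
        ((∀ q' ∈ n, ((q' : ℕ) : 𝓞 K) ∉ v'.asIdeal) →
          x ∈ selmerLocalKer (W.baseChange K) (v'.adicCompletion K) ((p ^ 1 : ℕ) : ℤ)) ∧
        (∀ q' ∈ n, ((q' : ℕ) : 𝓞 K) ∈ v'.asIdeal →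
          x ∈ toricLocalKer (W.baseChange K) (v'.adicCompletion K) ((p ^ 1 : ℕ) : ℤ))) with hREL
  have hREL_add : ∀ x y, REL x → REL y → REL (x + y) := fun x y hx hy ↦
    ⟨fun u ↦ add_mem (hx.1 u) (hy.1 u), fun v' hv' ↦
      ⟨fun h ↦ add_mem ((hx.2 v' hv').1 h) ((hy.2 v' hv').1 h),
        fun q' hq' hq'v' ↦ add_mem ((hx.2 v' hv').2 q' hq' hq'v') ((hy.2 v' hv').2 q' hq' hq'v')⟩⟩
  have hREL_sub : ∀ x y, REL x → REL y → REL (x - y) := fun x y hx hy ↦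
    ⟨fun u ↦ sub_mem (hx.1 u) (hy.1 u), fun v' hv' ↦
      ⟨fun h ↦ sub_mem ((hx.2 v' hv').1 h) ((hy.2 v' hv').1 h),
        fun q' hq' hq'v' ↦ sub_mem ((hx.2 v' hv').2 q' hq' hq'v') ((hy.2 v' hv').2 q' hq' hq'v')⟩⟩
  have hREL_zsmul : ∀ (a : ℤ) x, REL x → REL (a • x) := fun a x hx ↦
    ⟨fun u ↦ AddSubgroup.zsmul_mem _ (hx.1 u) a, fun v' hv' ↦
      ⟨fun h ↦ AddSubgroup.zsmul_mem _ ((hx.2 v' hv').1 h) a,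
        fun q' hq' hq'v' ↦ AddSubgroup.zsmul_mem _ ((hx.2 v' hv').2 q' hq' hq'v') a⟩⟩
  have hREL_τ : ∀ x, REL x → REL (τ x) := fun x hx ↦ conjAct_mem_relaxedAt W K p hK c n (q : ℕ) x hx
  -- (1) the jump: a relaxed class `g` with `loc_v g ≠ 0`
  obtain ⟨g, hginf, hgfin, hgv⟩ := exists_relaxed_notMem_torsionLocalKer_of_admQ W K p hK hPT n q v hqn hv
  have hgREL : REL g := ⟨hginf, fun v' hv' ↦ hgfin v' (fun h ↦ hv' (h ▸ hv))⟩
  -- (2) the eigen-components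
  obtain ⟨u, hu⟩ := exists_two_mul_zsmul_eq_of_odd W K p (hp.odd_of_ne_two hp2)
  set gp := u • (g + τ g) with hgp
  set gm := u • (g - τ g) with hgm
  have hgp_τ : τ gp = sgnP true • gp := by
    rw [show sgnP true = 1 from rfl, one_smul, hgp, map_zsmul, map_add, hττ, add_comm (τ g) g]
  have hgm_τ : τ gm = sgnP false • gm := by
    rw [show sgnP false = -1 from rfl, neg_one_zsmul, hgm, map_zsmul, map_sub, hττ, ← neg_sub g (τ g), zsmul_neg]
  have hsum_pm : gp + gm = g := by
    have : u • (g + τ g) + u • (g - τ g) = (2 * u) • g := by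
      rw [← zsmul_add, show g + τ g + (g - τ g) = g + g by abel, ← two_zsmul, smul_smul, mul_comm]
    rw [hgp, hgm, this, hu g]
  have hgpREL : REL gp := hREL_zsmul u _ (hREL_add _ _ hgREL (hREL_τ g hgREL))
  have hgmREL : REL gm := hREL_zsmul u _ (hREL_sub _ _ hgREL (hREL_τ g hgREL))
  -- the `s`-component and the `¬s`-component
  obtain ⟨gS, gN, hgS_τ, hgN_τ, hgS, hgN, hsumSN⟩ : ∃ gS gN : Vp W K p, τ gS = sgnP s • gS ∧ τ gN = sgnP (!s) • gN ∧
      REL gS ∧ REL gN ∧ gS + gN = g := by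
    cases s
    · exact ⟨gm, gp, hgm_τ, hgp_τ, hgmREL, hgpREL, by rw [add_comm]; exact hsum_pm⟩
    · exact ⟨gp, gm, hgp_τ, hgm_τ, hgpREL, hgmREL, hsum_pm⟩
  -- the sign of `v` is `s` (from `z`), so `loc_v gN = 0` and `loc_v gS ≠ 0`
  set locv := (W.baseChange K).torsionLocMap (v.adicCompletion K) ((p ^ 1 : ℕ) : ℤ) with hlocv
  have hNodd : Odd (((p ^ 1 : ℕ) : ℤ)) := by
    rw [pow_one]; exact_mod_cast hp.odd_of_ne_two hp2
  have hNloc : ∀ y : Vp W K p, ((p ^ 1 : ℕ) : ℤ) • locv y = 0 := fun y ↦ zsmul_discreteH1_torsion ((p ^ 1 : ℕ) : ℤ) _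
  obtain ⟨sv, hsv⟩ := localEquiv_of_admQ W K p hK2 hc1 q
  have hsvs : sv = s := by
    by_contra hne
    exact hzv (loc_eq_zero_of_sign_ne_odd τ locv (hsv v hv) hzs hne hNodd (hNloc z))
  have hgN0 : locv gN = 0 := by
    have hne : sv ≠ !s := by rw [hsvs]; cases s <;> decide
    exact loc_eq_zero_of_sign_ne_odd τ locv (hsv v hv) hgN_τ hne hNodd (hNloc gN)
  have hgSv : gS ∉ (W.baseChange K).torsionLocalKer (v.adicCompletion K) ((p ^ 1 : ℕ) : ℤ) := by
    intro h
    apply hgv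
    have hN' : gN ∈ (W.baseChange K).torsionLocalKer (v.adicCompletion K) ((p ^ 1 : ℕ) : ℤ) :=
      AddMonoidHom.mem_ker.mpr hgN0
    rw [← hsumSN]
    exact add_mem h hN'
  -- (3) isotropy of `loc_v gS`: Poitou–Tate reciprocity + toric isotropy above `n`
  haveI : CompactSpace (absoluteGaloisGroup K) := absoluteGaloisGroup_compactSpace K
  haveI : Finite (Literature.NumberTheory.GaloisRepresentations.DiscreteGaloisModule.MuCarrier K (p ^ 1)) :=
    Literature.NumberTheory.EllipticCurves.finite_muCarrier (p ^ 1) K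
  haveI : Finite (geomTorsion (W.baseChange K) ((p ^ 1 : ℕ) : ℤ)) :=
    finite_geomTorsion_of_neZero (W.baseChange K) (p ^ 1)
  have h2p : 2 ≤ p ^ 1 := by rw [pow_one]; exact hp.two_le
  obtain ⟨e, hμ, hadd₁, hadd₂, halt, hnondeg, hgal⟩ :=
    exists_weilPairing_holds (W.baseChange K) (p ^ 1) h2p (by exact_mod_cast pow_ne_zero 1 hp.ne_zero)
  obtain ⟨inv, hperf, hsum, -, -⟩ := hPT (p ^ 1)
  set loc := galoisCohomology.localization ((W.baseChange K).torsionGaloisModule ((p ^ 1 : ℕ) : ℤ)) (Sum.inr v) 1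
    with hloc
  -- the finite set of places above `n` and `S' = {v} ∪ (places above n)`
  have hnfin : {v' : HeightOneSpectrum (𝓞 K) | ∃ q' ∈ n, ((q' : ℕ) : 𝓞 K) ∈ v'.asIdeal}.Finite := by
    have hq : ∀ q' : AdmQ W K p, {v' : HeightOneSpectrum (𝓞 K) | ((q' : ℕ) : 𝓞 K) ∈ v'.asIdeal}.Finite := by
      intro q'
      have hq0' : (Ideal.span {((q' : ℕ) : 𝓞 K)} : Ideal (𝓞 K)) ≠ 0 := by
        rw [Ne, Ideal.zero_eq_bot, Ideal.span_singleton_eq_bot]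
        exact_mod_cast q'.2.1.ne_zero
      exact (Ideal.finite_factors hq0').subset fun v' hv' ↦ (Ideal.dvd_span_singleton).mpr hv'
    refine ((n : Set (AdmQ W K p)).toFinite.biUnion fun q' _ ↦ hq q').subset ?_
    intro v' hv'
    obtain ⟨q', hq'n, hq'v⟩ := hv'
    exact Set.mem_biUnion (Finset.mem_coe.mpr hq'n) hq'v
  set Nf : Finset (Place K) := hnfin.toFinset.image Sum.inr with hNf
  set S' : Finset (Place K) := insert (Sum.inr v) Nf with hS'
  have hvNf : (Sum.inr v : Place K) ∉ Nf := by
    intro h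
    rw [hNf, Finset.mem_image] at h
    obtain ⟨v', hv', hvv'⟩ := h
    have hv'v : v' = v := Sum.inr_injective hvv'
    rw [Set.Finite.mem_toFinset] at hv'
    obtain ⟨q', hq', hq'v'⟩ := hv'
    exact hqn' q' hq' v' hq'v' (hv'v ▸ hv)
  have hgS_out : gS ∈ kummerOutside (W.baseChange K) (p ^ 1) S' := by
    refine (mem_kummerOutside_iff (W.baseChange K) (p ^ 1) S' gS).mpr ?_
    intro pl hpl
    rcases pl with u | v'
    · have h := hgS.1 u
      exact (mem_selmerLocalKer_iff_localization_mem_kummer_inf_P W K p u gS).mp h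
    · have hv'v : v' ≠ v := fun h ↦ hpl (by rw [hS', h]; exact Finset.mem_insert_self _ _)
      have hv'q : ((q : ℕ) : 𝓞 K) ∉ v'.asIdeal := fun h ↦ hv'v (huniq v' h)
      have hv'n : ∀ q' ∈ n, ((q' : ℕ) : 𝓞 K) ∉ v'.asIdeal := by
        intro q' hq' hq'v'
        apply hpl
        rw [hS', Finset.mem_insert, hNf, Finset.mem_image]
        exact Or.inr ⟨v', (Set.Finite.mem_toFinset _).mpr ⟨q', hq', hq'v'⟩, rfl⟩
      exact (mem_selmerLocalKer_iff_localization_mem_kummer_P W K p v' gS).mp ((hgS.2 v' hv'q).1 hv'n)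
  have hiso : invWeilPairing (W.baseChange K) (p ^ 1) e hμ hadd₁ hadd₂ hgal inv (Sum.inr v) (loc gS) (loc gS) = 0 := by
    have hrec := KummerPT.sum_invWeilPairing_localization_eq_zero_of_mem_kummerOutside (W.baseChange K) (p ^ 1) e hμ
      hadd₁ hadd₂ hgal halt inv hsum S' hgS_out hgS_out
    rw [hS', Finset.sum_insert hvNf] at hrec
    have hzero : ∑ pl ∈ Nf, invWeilPairing (W.baseChange K) (p ^ 1) e hμ hadd₁ hadd₂ hgal inv pl
        (galoisCohomology.localization ((W.baseChange K).torsionGaloisModule ((p ^ 1 : ℕ) : ℤ)) pl 1 gS)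
        (galoisCohomology.localization ((W.baseChange K).torsionGaloisModule ((p ^ 1 : ℕ) : ℤ)) pl 1 gS) = 0 := by
      refine Finset.sum_eq_zero fun pl hpl ↦ ?_
      rw [hNf, Finset.mem_image] at hpl
      obtain ⟨v', hv', rfl⟩ := hpl
      rw [Set.Finite.mem_toFinset] at hv'
      obtain ⟨q', hq', hq'v'⟩ := hv'
      have hv'q : ((q : ℕ) : 𝓞 K) ∉ v'.asIdeal := hqn' q' hq' v' hq'v'
      have htor : gS ∈ toricLocalKer (W.baseChange K) (v'.adicCompletion K) ((p ^ 1 : ℕ) : ℤ) :=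
        (hgS.2 v' hv'q).2 q' hq' hq'v'
      have htor' := (mem_toricLocalKer_iff_res_mem_toricLocalCondition (W.baseChange K) (p ^ 1)
        (v'.adicCompletion K) gS).mp htor
      have h0 := htorIso_toricLocalCondition W K p hK2 q' v' hq'v' e hμ hadd₁ hadd₂ halt hgal _ htor' _ htor'
      rw [invWeilPairing_apply]
      exact (congrArg (inv (Sum.inr v')) h0).trans (map_zero _)
    rw [hzero, add_zero] at hrec
    exact hrec
  -- (4) the hyperbolic plane: `gS` is Kummer or toric at `v`; Kummer is impossible
  have hdich := mem_selmerLocalKer_or_mem_toricLocalKer_of_isotropic W K p hK hp2 q v hv e hμ hadd₁ hadd₂ halt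
    hnondeg hgal inv hperf hzK hzv hiso
  have hgS_tor : gS ∈ toricLocalKer (W.baseChange K) (v.adicCompletion K) ((p ^ 1 : ℕ) : ℤ) := by
    rcases hdich with hkum | htor
    · exfalso
      have hgSn : gS ∈ SelQP W K p c n s := by
        refine (mem_selQP_iff W K p c n s gS).mpr ⟨hgS_τ, hgS.1, fun v' hv'n ↦ ?_, fun q' hq' v' hq'v' ↦ ?_⟩
        · by_cases hv'q : ((q : ℕ) : 𝓞 K) ∈ v'.asIdeal
          · rw [huniq v' hv'q]; exact hkum
          · exact (hgS.2 v' hv'q).1 hv'n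
        · exact (hgS.2 v' (hqn' q' hq' v' hq'v')).2 q' hq' hq'v'
      exact hgSv (hSel gS hgSn)
    · exact htor
  have hgSM : gS ∈ SelQP W K p c (insert q n) s := by
    refine (mem_selQP_iff W K p c (insert q n) s gS).mpr ⟨hgS_τ, hgS.1, fun v' hv'n ↦ ?_, fun q' hq' v' hq'v' ↦ ?_⟩
    · have hv'q : ((q : ℕ) : 𝓞 K) ∉ v'.asIdeal := hv'n q (Finset.mem_insert_self _ _)
      exact (hgS.2 v' hv'q).1 fun q' hq' ↦ hv'n q' (Finset.mem_insert_of_mem hq')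
    · rcases Finset.mem_insert.mp hq' with rfl | hq'
      · rw [huniq v' hq'v']; exact hgS_tor
      · exact (hgS.2 v' (hqn' q' hq' v' hq'v')).2 q' hq' hq'v'
  -- (5) counting
  set M := SelQP W K p c (insert q n) s with hM
  set N := SelQP W K p c n s with hN
  -- the local `ZMod p`-structure and the localisation as a linear map
  haveI : Module (ZMod p)
      (galoisCohomology (((W.baseChange K).torsionGaloisModule ((p ^ 1 : ℕ) : ℤ)).toLocal (Sum.inr v)) 1) :=
    AddCommGroup.zmodModule (fun y ↦ by
      have h := KummerPT.nsmul_galoisCohomology_toLocal_eq_zero (W.baseChange K) (p ^ 1) (Sum.inr v) y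
      simpa using h)
  set locZ : Vp W K p →ₗ[ZMod p]
      galoisCohomology (((W.baseChange K).torsionGaloisModule ((p ^ 1 : ℕ) : ℤ)).toLocal (Sum.inr v)) 1 :=
    AddMonoidHom.toZModLinearMap p (loc : Vp W K p →+ _) with hlocZ
  have hlocZ_apply : ∀ y : Vp W K p, locZ y = loc y := fun _ ↦ rfl
  have hker : ∀ y : Vp W K p, y ∈ (W.baseChange K).torsionLocalKer (v.adicCompletion K) ((p ^ 1 : ℕ) : ℤ) ↔
      loc y = 0 := by
    intro y
    constructor
    · intro h
      rw [← ker_localization_eq_torsionLocalKer_P W K p v] at h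
      exact h
    · intro h
      have h' : y ∈ (galoisCohomology.localization ((W.baseChange K).torsionGaloisModule ((p ^ 1 : ℕ) : ℤ))
          (Sum.inr v) 1).ker := h
      rwa [ker_localization_eq_torsionLocalKer_P W K p v] at h'
  -- `N = M ∩ ker loc_v`
  have hstep := selQP_insert_inf_kummer_eq W K p c n q hqn s
  have hNM : ∀ y : Vp W K p, y ∈ N ↔ y ∈ M ∧ loc y = 0 := by
    intro y
    constructor
    · intro hy
      have hy0 : y ∈ (W.baseChange K).torsionLocalKer (v.adicCompletion K) ((p ^ 1 : ℕ) : ℤ) := hSel y hy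
      refine ⟨?_, (hker y).mp hy0⟩
      have hT : y ∈ AddSubgroup.toZModSubmodule p
          (⨅ (v' : HeightOneSpectrum (𝓞 K)) (_ : ((q : ℕ) : 𝓞 K) ∈ v'.asIdeal),
            toricLocalKer (W.baseChange K) (v'.adicCompletion K) ((p ^ 1 : ℕ) : ℤ)) := by
        simp only [AddSubgroup.mem_toZModSubmodule, AddSubgroup.mem_iInf]
        intro v' hv'
        rw [huniq v' hv']
        exact torsionLocalKer_le_toricLocalKer W K _ _ hy0
      have h : y ∈ SelQP W K p c (insert q n) s ⊓ AddSubgroup.toZModSubmodule p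
          (⨅ (v' : HeightOneSpectrum (𝓞 K)) (_ : ((q : ℕ) : 𝓞 K) ∈ v'.asIdeal),
            selmerLocalKer (W.baseChange K) (v'.adicCompletion K) ((p ^ 1 : ℕ) : ℤ)) := by
        rw [hstep]
        exact Submodule.mem_inf.mpr ⟨hy, hT⟩
      exact (Submodule.mem_inf.mp h).1
    · rintro ⟨hy, hy0⟩
      have hy0' : y ∈ (W.baseChange K).torsionLocalKer (v.adicCompletion K) ((p ^ 1 : ℕ) : ℤ) := (hker y).mpr hy0
      have hK' : y ∈ AddSubgroup.toZModSubmodule p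
          (⨅ (v' : HeightOneSpectrum (𝓞 K)) (_ : ((q : ℕ) : 𝓞 K) ∈ v'.asIdeal),
            selmerLocalKer (W.baseChange K) (v'.adicCompletion K) ((p ^ 1 : ℕ) : ℤ)) := by
        simp only [AddSubgroup.mem_toZModSubmodule, AddSubgroup.mem_iInf]
        intro v' hv'
        rw [huniq v' hv']
        exact (W.baseChange K).torsionLocalKer_le_selmerLocalKer (v.adicCompletion K) _ hy0'
      have h : y ∈ SelQP W K p c n s ⊓ AddSubgroup.toZModSubmodule p
          (⨅ (v' : HeightOneSpectrum (𝓞 K)) (_ : ((q : ℕ) : 𝓞 K) ∈ v'.asIdeal),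
            toricLocalKer (W.baseChange K) (v'.adicCompletion K) ((p ^ 1 : ℕ) : ℤ)) := by
        rw [← hstep]
        exact Submodule.mem_inf.mpr ⟨hy, hK'⟩
      exact (Submodule.mem_inf.mp h).1
  have hNeq : N = M ⊓ LinearMap.ker locZ := by
    ext y
    rw [Submodule.mem_inf, LinearMap.mem_ker, hlocZ_apply]
    exact hNM y
  -- the toric line at `v` has at most `p` elements (Lagrangian in a group of order `≤ p²`)
  haveI : Finite (galoisCohomology (((W.baseChange K).torsionGaloisModule ((p ^ 1 : ℕ) : ℤ)).toLocal (Sum.inr v)) 1) :=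
    KummerPT.finite_galoisCohomology_toLocal_inr (W.baseChange K) (p ^ 1) v
  have hOle : Nat.card (toricLocalCondition (W.baseChange K) (v.adicCompletion K) ((p ^ 1 : ℕ) : ℤ)) ≤ p := by
    have hcnt := natCard_galoisCohomology_one_le_mul_natCard_toricLocalCondition W K p hK2 q v hv
    have hinj : Injective (inv (Sum.inr v)) := (hperf v).1.1
    have hA := KummerPT.nsmul_galoisCohomology_toLocal_eq_zero (W.baseChange K) (p ^ 1) (Sum.inr v)
    have hflip := KummerPT.invWeilPairing_flip_bijective (W.baseChange K) (p ^ 1) e hμ hadd₁ hadd₂ hgal hnondeg inv v hinj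
    have hOann := annRight_invWeilPairing_eq_of_isotropic_of_card_le (W.baseChange K) (p ^ 1) e hμ hadd₁ hadd₂ hgal
      hnondeg inv v hinj (toricLocalCondition (W.baseChange K) (v.adicCompletion K) ((p ^ 1 : ℕ) : ℤ))
      (fun a ha a' ha' ↦ htorIso_toricLocalCondition W K p hK2 q v hv e hμ hadd₁ hadd₂ halt hgal a ha a' ha') hcnt
    have hmul := natCard_annRight_mul hA _ hflip
      (toricLocalCondition (W.baseChange K) (v.adicCompletion K) ((p ^ 1 : ℕ) : ℤ))
    rw [hOann] at hmul
    have hH : Nat.card (galoisCohomology (((W.baseChange K).torsionGaloisModule ((p ^ 1 : ℕ) : ℤ)).toLocal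
        (Sum.inr v)) 1) ≤ p ^ 2 := by
      obtain ⟨-, hpv⟩ := hasGoodReductionAt_of_isAdmissiblePrime W K q.2 v hv
      have hle := natCard_invariants_le_of_admQ W K p hK2 q v hv
      rw [Nat.pow_one]
      rw [Nat.pow_one] at hle
      rw [Int.cast_natCast] at hpv
      rw [natCard_galoisCohomology_one_torsion_eq_sq (W.baseChange K) p v hpv]
      exact Nat.pow_le_pow_left hle 2
    have hO2 : Nat.card (toricLocalCondition (W.baseChange K) (v.adicCompletion K) ((p ^ 1 : ℕ) : ℤ)) *
        Nat.card (toricLocalCondition (W.baseChange K) (v.adicCompletion K) ((p ^ 1 : ℕ) : ℤ)) ≤ p * p :=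
      calc _ = _ := hmul
        _ ≤ p ^ 2 := hH
        _ = p * p := sq p
    exact Nat.mul_self_le_mul_self_iff.mp hO2
  -- dimension `≤ 1` over `ZMod p` (same structure, on the `restrictField` form = syntactic home of `toricLocalCondition`)
  letI : Module (ZMod p) (galoisCohomology (GaloisRep.restrictField (v.adicCompletion K)
      ((W.baseChange K).torsionGaloisModule ((p ^ 1 : ℕ) : ℤ))) 1) :=
    ‹Module (ZMod p) (galoisCohomology (((W.baseChange K).torsionGaloisModule ((p ^ 1 : ℕ) : ℤ)).toLocal (Sum.inr v)) 1)›
  haveI : Finite (galoisCohomology (GaloisRep.restrictField (v.adicCompletion K)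
      ((W.baseChange K).torsionGaloisModule ((p ^ 1 : ℕ) : ℤ))) 1) :=
    KummerPT.finite_galoisCohomology_toLocal_inr (W.baseChange K) (p ^ 1) v
  haveI : Finite (AddSubgroup.toZModSubmodule p
      (toricLocalCondition (W.baseChange K) (v.adicCompletion K) ((p ^ 1 : ℕ) : ℤ))) :=
    Finite.of_equiv _ (Equiv.setCongr (AddSubgroup.coe_toZModSubmodule p _).symm)
  haveI : Module.Finite (ZMod p) (AddSubgroup.toZModSubmodule p
      (toricLocalCondition (W.baseChange K) (v.adicCompletion K) ((p ^ 1 : ℕ) : ℤ))) := Module.Finite.of_finite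
  have hΛ1 : finrank (ZMod p) (AddSubgroup.toZModSubmodule p
      (toricLocalCondition (W.baseChange K) (v.adicCompletion K) ((p ^ 1 : ℕ) : ℤ))) ≤ 1 := by
    have hcardp := Literature.NumberTheory.EllipticCurves.pow_finrank_eq_natCard (p := p)
      (AddSubgroup.toZModSubmodule p (toricLocalCondition (W.baseChange K) (v.adicCompletion K) ((p ^ 1 : ℕ) : ℤ)))
    have hcoe : Nat.card (AddSubgroup.toZModSubmodule p
        (toricLocalCondition (W.baseChange K) (v.adicCompletion K) ((p ^ 1 : ℕ) : ℤ))) =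
        Nat.card (toricLocalCondition (W.baseChange K) (v.adicCompletion K) ((p ^ 1 : ℕ) : ℤ)) :=
      Nat.card_congr (Equiv.setCongr (AddSubgroup.coe_toZModSubmodule p _))
    rw [hcoe] at hcardp
    by_contra hlt
    push Not at hlt
    have h2 : p ^ 2 ≤ p ^ finrank (ZMod p) (AddSubgroup.toZModSubmodule p
        (toricLocalCondition (W.baseChange K) (v.adicCompletion K) ((p ^ 1 : ℕ) : ℤ))) :=
      Nat.pow_le_pow_right hp.pos hlt
    rw [hcardp] at h2
    have hp2' : 2 ≤ p := hp.two_le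
    nlinarith
  -- the localisations of `M` lie in the toric line
  have hmem : ∀ y ∈ M, locZ y ∈ AddSubgroup.toZModSubmodule p
      (toricLocalCondition (W.baseChange K) (v.adicCompletion K) ((p ^ 1 : ℕ) : ℤ)) := by
    intro y hy
    change loc y ∈ toricLocalCondition (W.baseChange K) (v.adicCompletion K) ((p ^ 1 : ℕ) : ℤ)
    have htor : y ∈ toricLocalKer (W.baseChange K) (v.adicCompletion K) ((p ^ 1 : ℕ) : ℤ) :=
      ((mem_selQP_iff W K p c (insert q n) s y).mp hy).2.2.2 q (Finset.mem_insert_self _ _) v hv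
    exact (mem_toricLocalKer_iff_res_mem_toricLocalCondition (W.baseChange K) (p ^ 1) (v.adicCompletion K) y).mp htor
  haveI : FiniteDimensional (ZMod p) M := finiteDimensional_selQP W K p c (insert q n) s
  have hfr := Summit.BirchSwinnertonDyer.Rank1Residual.X11b.Three.Koly.ZhangInduction.finrank_inf_ker_add_one_of_line
    M locZ _ hΛ1 hmem ⟨gS, hgSM, by rw [hlocZ_apply]; exact fun h ↦ hgSv ((hker gS).mpr h)⟩
  rw [← hNeq] at hfr
  omega

end Summit.BirchSwinnertonDyer.BirchSwinnertonDyer.Theorems.AdditiveKoly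

end
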